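import Literature.InformationTheory.QuantumCodes.QuantumExpanderSmallSetFlip
import HarnessLib

/-!
# Quantum expander codes: the other flips of a critical generator (Leverrier–Tillich–Zémor 2015, App. B
# eq. (partial2) and "its complement in `g_{ba}`") — PROOF

Topic `Literature/InformationTheory/QuantumCodes` (venture QEC; small-set-flip analysis for Algorithm 1,
step 1 of 3). Source: LTZ15 = arXiv:1504.00822v1, App. B "Proof of Lemma 8" (p0013 L10 - p0014 L50).
Vocabulary of `QuantumExpanderCriticalGenerators.lean` (`IsCritical`, `critX`, `critY`, `critFlip`, `nbrs`).

* `expanderHX_mulVec_flipVec_parts`, `card_flipVec_parts`, `flipVec_parts_mem_smallSets` — flip sets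
  `{αa : α ∈ S} ∪ {bβ : β ∈ T}` inside a generator for arbitrary index parts;
* `syndromeDecrease_flipBar_ge` — **eq. (partial2), PROVED**: flipping `x̄_a ∪ x̄_b` lowers `|σ_X|` by at
  least `|x_a||x̄_b| + |x̄_a||x_b| − |x̄_a||χ_b| − |χ_a||x̄_b|`;
* `syndromeDecrease_parts_compl` — the complement of a part-flip inside the generator has the same
  syndrome decrease (they differ by the generator, whose syndrome vanishes).
-/

namespace Literature.InformationTheory.QuantumCodes

namespace QuantumExpander

open Finset Matrix

variable {A B : Type*} [Fintype A] [Fintype B] [DecidableEq A] [DecidableEq B]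

/-- In `𝔽₂` a non-zero element is `1`. [folklore] -/
private theorem zmod2_eq_one_of_ne_zero' {z : ZMod 2} (h : z ≠ 0) : z = 1 := by
  revert z; decide

/-! ### Flip sets indexed by arbitrary parts of the generator: syndrome formula -/

/-- The syndrome of a flip set `{αa : α ∈ S} ∪ {bβ : β ∈ T}` inside the generator `g_{ba}` (any index
sets `S ⊆ A`, `T ⊆ B`): the check `αβ` is hit once by the `A²`-part iff `α ∈ S` and `β ∼ a`, once by the
`B²`-part iff `β ∈ T` and `α ∼ b`.
[cite: LeverrierTillichZemor2015, App. B (the regions S_{ab̄}, …; arXiv v1 p0013 L55-90)] -/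
theorem expanderHX_mulVec_flipVec_parts (H : Matrix B A (ZMod 2)) (b : B) (a : A) (S : Finset A)
    (T : Finset B) (α : A) (β : B) :
    (expanderHX H *ᵥ flipVec (S.image (fun α' => Sum.inl (α', a)) ∪ T.image (fun β' => Sum.inr (b, β'))))
        (α, β)
      = (if α ∈ S then H β a else 0) + (if β ∈ T then H b α else 0) := by
  classical
  set F := S.image (fun α' => (Sum.inl (α', a) : (A × A) ⊕ (B × B)))
    ∪ T.image (fun β' => Sum.inr (b, β')) with hF
  have hinl : ∀ α' a', (Sum.inl (α', a') ∈ F) ↔ a' = a ∧ α' ∈ S := by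
    intro α' a'
    rw [hF, Finset.mem_union, Finset.mem_image, Finset.mem_image]
    constructor
    · rintro (⟨α'', hα'', h⟩ | ⟨β'', _, h⟩)
      · simp only [Sum.inl.injEq, Prod.mk.injEq] at h
        obtain ⟨rfl, rfl⟩ := h; exact ⟨rfl, hα''⟩
      · cases h
    · rintro ⟨rfl, hα'⟩; exact Or.inl ⟨α', hα', rfl⟩
  have hinr : ∀ b' β', (Sum.inr (b', β') ∈ F) ↔ b' = b ∧ β' ∈ T := by
    intro b' β'
    rw [hF, Finset.mem_union, Finset.mem_image, Finset.mem_image]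
    constructor
    · rintro (⟨α'', _, h⟩ | ⟨β'', hβ'', h⟩)
      · cases h
      · simp only [Sum.inr.injEq, Prod.mk.injEq] at h
        obtain ⟨rfl, rfl⟩ := h; exact ⟨rfl, hβ''⟩
    · rintro ⟨rfl, hβ'⟩; exact Or.inr ⟨β', hβ', rfl⟩
  rw [expanderHX_mulVec_apply]
  congr 1
  · have hval : ∀ a', flipVec F (Sum.inl (α, a')) = if a' = a ∧ α ∈ S then 1 else 0 := by
      intro a'; simp only [flipVec, hinl]
    simp_rw [hval]
    rw [Finset.sum_eq_single a]
    · by_cases h : α ∈ S <;> simp [h]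
    · intro a' _ hne; simp [hne]
    · intro h; exact absurd (Finset.mem_univ a) h
  · have hval : ∀ b', flipVec F (Sum.inr (b', β)) = if b' = b ∧ β ∈ T then 1 else 0 := by
      intro b'; simp only [flipVec, hinr]
    simp_rw [hval]
    rw [Finset.sum_eq_single b]
    · by_cases h : β ∈ T <;> simp [h]
    · intro b' _ hne; simp [hne]
    · intro h; exact absurd (Finset.mem_univ b) h

omit [Fintype A] [Fintype B] in
/-- Size of a flip set given by index parts: `|{αa : α ∈ S} ∪ {bβ : β ∈ T}| = |S| + |T|` (LTZ15's
`|x_a ∪ x_b| = Δ_B x + Δ_A y`, `|x̄_a ∪ x̄_b| = Δ_B x̄ + Δ_A ȳ`).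
[cite: LeverrierTillichZemor2015, App. B (reduced variables x, x̄, y, ȳ; arXiv v1 p0013 L22-27)] -/
theorem card_flipVec_parts (b : B) (a : A) (S : Finset A) (T : Finset B) :
    (S.image (fun α' => (Sum.inl (α', a) : (A × A) ⊕ (B × B))) ∪ T.image (fun β' => Sum.inr (b, β'))).card
      = S.card + T.card := by
  rw [Finset.card_union_of_disjoint, Finset.card_image_of_injective, Finset.card_image_of_injective]
  · intro β β' h; simpa using h
  · intro α α' h; simpa using h
  · rw [Finset.disjoint_left]
    intro q hq hq'
    obtain ⟨α, -, rfl⟩ := Finset.mem_image.1 hq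
    obtain ⟨β, -, h⟩ := Finset.mem_image.1 hq'
    cases h

/-- A flip set given by index parts `S ⊆ Γ(b)`, `T ⊆ Γ(a)` lies inside the generator `g_{ba}`; if it is
non-empty it is a small set. [cite: FawziGrospellierLeverrier2018, §2.3 (𝓕 = {F ⊆ x : x ∈ 𝒳})] -/
theorem flipVec_parts_mem_smallSets (H : Matrix B A (ZMod 2)) (b : B) (a : A) {S : Finset A}
    {T : Finset B} (hS : S ⊆ nbrs Hᵀ b) (hT : T ⊆ nbrs H a) (hne : S.Nonempty ∨ T.Nonempty) :
    S.image (fun α' => (Sum.inl (α', a) : (A × A) ⊕ (B × B))) ∪ T.image (fun β' => Sum.inr (b, β'))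
      ∈ smallSets (expanderHZ H) := by
  rw [smallSets, Finset.mem_erase]
  constructor
  · intro h
    rw [Finset.union_eq_empty, Finset.image_eq_empty, Finset.image_eq_empty] at h
    rcases hne with hS' | hT'
    · exact hS'.ne_empty h.1
    · exact hT'.ne_empty h.2
  · refine Finset.mem_biUnion.2 ⟨(b, a), Finset.mem_univ _, Finset.mem_powerset.2 ?_⟩
    intro q hq
    rw [genSupport, Finset.mem_filter]
    refine ⟨Finset.mem_univ _, ?_⟩
    rcases Finset.mem_union.1 hq with h | h
    · obtain ⟨α, hα, rfl⟩ := Finset.mem_image.1 h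
      have := mem_nbrs.1 (hS hα)
      rw [Matrix.transpose_apply] at this
      simpa [expanderHZ, HypergraphProduct.xMatrix_apply_inl] using this
    · obtain ⟨β, hβ, rfl⟩ := Finset.mem_image.1 h
      have := mem_nbrs.1 (hT hβ)
      simpa [expanderHZ, HypergraphProduct.xMatrix_apply_inr, Matrix.transpose_apply] using this

/-! ### The decrease `∂̄` for flipping `x̄_a ∪ x̄_b` (LTZ15 App. B eq. (partial2)) -/

/-- **The second decrease inequality of a critical generator** (LTZ15 eq. (partial2)): flipping the
ERROR-FREE clean part `x̄_a ∪ x̄_b` lowers the syndrome weight by at least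
`|x_a||x̄_b| + |x̄_a||x_b| − |x̄_a||χ_b| − |χ_a||x̄_b|` ("the syndrome is flipped from 1 to 0 on the
support `S_{ab̄}` and `S_{āb}` and possibly from 0 to 1 on `S_ā ∪ S_b̄`"). Here `x̄_a`, `x̄_b` are indexed
by `X̄ = {α ∈ Γ(b) ∖ Χa : αa ∉ E}`, `Ȳ = {β ∈ Γ(a) ∖ Χb : bβ ∉ E}`.
[cite: LeverrierTillichZemor2015, App. B eq. (partial2) (arXiv v1 p0013 L78-90)] -/
theorem syndromeDecrease_flipBar_ge {H : Matrix B A (ZMod 2)} {dA dB : ℕ} {δA δB : ℝ}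
    {e : (A × A) ⊕ (B × B) → ZMod 2} {b : B} {a : A} {Χa : Finset A}
    {Χb : Finset B} (hc : IsCritical H dA dB δA δB (supp e) b a Χa Χb) :
    let Xbar := (nbrs Hᵀ b \ Χa).filter fun α => e (Sum.inl (α, a)) = 0
    let Ybar := (nbrs H a \ Χb).filter fun β => e (Sum.inr (b, β)) = 0
    ((critX H e b a Χa).card : ℤ) * Ybar.card + (Xbar.card : ℤ) * (critY H e b a Χb).card
        - (Xbar.card : ℤ) * Χb.card - (Χa.card : ℤ) * Ybar.card
      ≤ syndromeDecrease (expanderHX H) (expanderHX H *ᵥ e)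
          (Xbar.image (fun α' => Sum.inl (α', a)) ∪ Ybar.image (fun β' => Sum.inr (b, β'))) := by
  classical
  intro Xbar Ybar
  set Xa := critX H e b a Χa with hXa
  set Yb := critY H e b a Χb with hYb
  set G := Xbar.image (fun α' => (Sum.inl (α', a) : (A × A) ⊕ (B × B)))
    ∪ Ybar.image (fun β' => Sum.inr (b, β')) with hG
  set σ := expanderHX H *ᵥ e with hσ
  set τ := expanderHX H *ᵥ flipVec G with hτ
  -- membership facts
  have hXa_mem : ∀ {α}, α ∈ Xa → α ∈ nbrs Hᵀ b \ Χa ∧ e (Sum.inl (α, a)) ≠ 0 := by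
    intro α h; rw [hXa, critX, Finset.mem_filter] at h; exact h
  have hXbar_mem : ∀ {α}, α ∈ Xbar → α ∈ nbrs Hᵀ b \ Χa ∧ e (Sum.inl (α, a)) = 0 := by
    intro α h; exact Finset.mem_filter.1 h
  have hYb_mem : ∀ {β}, β ∈ Yb → β ∈ nbrs H a \ Χb ∧ e (Sum.inr (b, β)) ≠ 0 := by
    intro β h; rw [hYb, critY, Finset.mem_filter] at h; exact h
  have hYbar_mem : ∀ {β}, β ∈ Ybar → β ∈ nbrs H a \ Χb ∧ e (Sum.inr (b, β)) = 0 := by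
    intro β h; exact Finset.mem_filter.1 h
  have hrow_of : ∀ {α}, α ∈ nbrs Hᵀ b \ Χa → H b α ≠ 0 := by
    intro α h
    have := mem_nbrs.1 (Finset.mem_sdiff.1 h).1
    rwa [Matrix.transpose_apply] at this
  have hcol_of : ∀ {β}, β ∈ nbrs H a \ Χb → H β a ≠ 0 := fun h => mem_nbrs.1 (Finset.mem_sdiff.1 h).1
  have hXbar_of : ∀ {α}, α ∈ nbrs Hᵀ b \ Χa → α ∉ Xa → α ∈ Xbar := by
    intro α hα hαX
    refine Finset.mem_filter.2 ⟨hα, ?_⟩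
    by_contra hne
    exact hαX (by rw [hXa, critX, Finset.mem_filter]; exact ⟨hα, hne⟩)
  have hYbar_of : ∀ {β}, β ∈ nbrs H a \ Χb → β ∉ Yb → β ∈ Ybar := by
    intro β hβ hβY
    refine Finset.mem_filter.2 ⟨hβ, ?_⟩
    by_contra hne
    exact hβY (by rw [hYb, critY, Finset.mem_filter]; exact ⟨hβ, hne⟩)
  -- regions
  set P1 := (Xa ×ˢ Ybar) ∪ (Xbar ×ˢ Yb) with hP1
  set P2 := (Xbar ×ˢ Χb) ∪ (Χa ×ˢ Ybar) with hP2
  have hτ_apply : ∀ α β, τ (α, β)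
      = (if α ∈ Xbar then H β a else 0) + (if β ∈ Ybar then H b α else 0) := by
    intro α β
    rw [hτ, hG]
    exact expanderHX_mulVec_flipVec_parts H b a Xbar Ybar α β
  -- (1) on `P1`: `1 → 0`
  have hP1_prop : ∀ c ∈ P1, σ c ≠ 0 ∧ (σ + τ) c = 0 := by
    rintro ⟨α, β⟩ hcmem
    rw [hP1, Finset.mem_union, Finset.mem_product, Finset.mem_product] at hcmem
    rcases hcmem with ⟨hαX, hβY⟩ | ⟨hαX, hβY⟩
    · obtain ⟨hα, heα⟩ := hXa_mem hαX
      obtain ⟨hβ, heβ⟩ := hYbar_mem hβY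
      have hσc : σ (α, β) = e (Sum.inl (α, a)) := by
        rw [hσ, expanderHX_mulVec_apply_of_isCritical hc hα hβ, heβ, add_zero]
      have hτc : τ (α, β) = 1 := by
        rw [hτ_apply, if_neg, if_pos hβY, zero_add, zmod2_eq_one_of_ne_zero' (hrow_of hα)]
        intro hαXbar
        exact heα (hXbar_mem hαXbar).2
      refine ⟨by rw [hσc]; exact heα, ?_⟩
      rw [Pi.add_apply, hσc, hτc, zmod2_eq_one_of_ne_zero' heα]
      decide
    · obtain ⟨hα, heα⟩ := hXbar_mem hαX
      obtain ⟨hβ, heβ⟩ := hYb_mem hβY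
      have hσc : σ (α, β) = e (Sum.inr (b, β)) := by
        rw [hσ, expanderHX_mulVec_apply_of_isCritical hc hα hβ, heα, zero_add]
      have hτc : τ (α, β) = 1 := by
        rw [hτ_apply, if_pos hαX, if_neg, add_zero, zmod2_eq_one_of_ne_zero' (hcol_of hβ)]
        intro hβYbar
        exact heβ (hYbar_mem hβYbar).2
      refine ⟨by rw [hσc]; exact heβ, ?_⟩
      rw [Pi.add_apply, hσc, hτc, zmod2_eq_one_of_ne_zero' heβ]
      decide
  -- (2) off `P1 ∪ P2`: unchanged
  have hrest : ∀ c, c ∉ P1 → c ∉ P2 → (σ + τ) c = σ c := by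
    rintro ⟨α, β⟩ h1 h2
    rw [hP1, Finset.mem_union, Finset.mem_product, Finset.mem_product, not_or] at h1
    rw [hP2, Finset.mem_union, Finset.mem_product, Finset.mem_product, not_or] at h2
    rw [Pi.add_apply, hτ_apply]
    by_cases hαX : α ∈ Xbar
    · rw [if_pos hαX]
      by_cases hβa : H β a = 0
      · rw [hβa, zero_add]
        by_cases hβY : β ∈ Ybar
        · exact absurd hβa (hcol_of (hYbar_mem hβY).1)
        · rw [if_neg hβY, add_zero]
      · -- `β ∈ Γ(a)`: `β ∈ Yb ∪ Ybar ∪ Χb`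
        have hβY : β ∈ Ybar := by
          by_contra hβY
          by_cases hβΧ : β ∈ Χb
          · exact h2.1 ⟨hαX, hβΧ⟩
          · have hβsd : β ∈ nbrs H a \ Χb := Finset.mem_sdiff.2 ⟨mem_nbrs.2 hβa, hβΧ⟩
            have hβYb : β ∈ Yb := by
              by_contra hβYb
              exact hβY (hYbar_of hβsd hβYb)
            exact h1.2 ⟨hαX, hβYb⟩
        rw [if_pos hβY, zmod2_eq_one_of_ne_zero' hβa,
          zmod2_eq_one_of_ne_zero' (hrow_of (hXbar_mem hαX).1)]
        have : (1 : ZMod 2) + 1 = 0 := by decide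
        rw [this, add_zero]
    · rw [if_neg hαX, zero_add]
      by_cases hβY : β ∈ Ybar
      · rw [if_pos hβY]
        by_cases hbα : H b α = 0
        · rw [hbα, add_zero]
        · exfalso
          by_cases hαΧ : α ∈ Χa
          · exact h2.2 ⟨hαΧ, hβY⟩
          · have hαsd : α ∈ nbrs Hᵀ b \ Χa :=
              Finset.mem_sdiff.2 ⟨mem_nbrs.2 (by rwa [Matrix.transpose_apply]), hαΧ⟩
            have hαXa : α ∈ Xa := by
              by_contra hαXa
              exact hαX (hXbar_of hαsd hαXa)
            exact h1.1 ⟨hαXa, hβY⟩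
      · rw [if_neg hβY, add_zero]
  -- (3) counting
  have hdec : syndromeDecrease (expanderHX H) σ G = (hammingNorm σ : ℤ) - hammingNorm (σ + τ) := by
    rw [syndromeDecrease]
  rw [hdec]
  have hnormσ : (hammingNorm σ : ℤ) = ∑ c, (if σ c ≠ 0 then 1 else 0 : ℤ) := by
    simp only [hammingNorm]
    rw [Finset.card_filter]
    push_cast
    rfl
  have hnormσ' : (hammingNorm (σ + τ) : ℤ) = ∑ c, (if (σ + τ) c ≠ 0 then 1 else 0 : ℤ) := by
    simp only [hammingNorm]
    rw [Finset.card_filter]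
    push_cast
    rfl
  have hpt : ∀ c, (if c ∈ P1 then (1 : ℤ) else 0) - (if c ∈ P2 then 1 else 0)
      ≤ (if σ c ≠ 0 then (1 : ℤ) else 0) - (if (σ + τ) c ≠ 0 then 1 else 0) := by
    intro c
    have hA : (0 : ℤ) ≤ (if σ c ≠ 0 then (1 : ℤ) else 0) := by split_ifs <;> norm_num
    have hB : (if (σ + τ) c ≠ 0 then (1 : ℤ) else 0) ≤ 1 := by split_ifs <;> norm_num
    have hC : (0 : ℤ) ≤ (if c ∈ P2 then (1 : ℤ) else 0) := by split_ifs <;> norm_num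
    by_cases h1 : c ∈ P1
    · obtain ⟨hs, hs'⟩ := hP1_prop c h1
      have e1 : (if σ c ≠ 0 then (1 : ℤ) else 0) = 1 := if_pos hs
      have e2 : (if (σ + τ) c ≠ 0 then (1 : ℤ) else 0) = 0 := by rw [hs']; simp
      rw [e1, e2, if_pos h1]
      linarith
    · rw [if_neg h1]
      by_cases h2 : c ∈ P2
      · rw [if_pos h2]; linarith
      · rw [if_neg h2, hrest c h1 h2]; simp
  have hsum := Finset.sum_le_sum fun c (_ : c ∈ (Finset.univ : Finset (A × B))) => hpt c
  rw [Finset.sum_sub_distrib, Finset.sum_sub_distrib, ← hnormσ, ← hnormσ'] at hsum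
  have hP1card : ∑ c : A × B, (if c ∈ P1 then (1 : ℤ) else 0) = P1.card := by
    rw [Finset.sum_boole, Finset.filter_mem_eq_inter, Finset.univ_inter]
  have hP2card : ∑ c : A × B, (if c ∈ P2 then (1 : ℤ) else 0) = P2.card := by
    rw [Finset.sum_boole, Finset.filter_mem_eq_inter, Finset.univ_inter]
  rw [hP1card, hP2card] at hsum
  have hdisjX : Disjoint Xa Xbar := by
    rw [Finset.disjoint_left]
    intro α h1 h2
    exact (hXa_mem h1).2 (hXbar_mem h2).2
  have hP1eq : (P1.card : ℤ) = Xa.card * Ybar.card + Xbar.card * Yb.card := by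
    rw [hP1, Finset.card_union_of_disjoint, Finset.card_product, Finset.card_product]
    · push_cast; ring
    · rw [Finset.disjoint_left]
      rintro ⟨α, β⟩ h h'
      rw [Finset.mem_product] at h h'
      exact Finset.disjoint_left.1 hdisjX h.1 h'.1
  have hP2le : (P2.card : ℤ) ≤ Xbar.card * Χb.card + Χa.card * Ybar.card := by
    have := Finset.card_union_le (Xbar ×ˢ Χb) (Χa ×ˢ Ybar)
    rw [Finset.card_product, Finset.card_product] at this
    rw [hP2]; exact_mod_cast this
  rw [hP1eq] at hsum
  linarith

/-- **The complement flip has the same syndrome effect** (LTZ15: "flip either `x̄_a ∪ x̄_b` or its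
complement in `g_{ba}`"): the flip set `{αa : α ∈ Γ(b) ∖ X̄} ∪ {bβ : β ∈ Γ(a) ∖ Ȳ}` differs from
`{αa : α ∈ X̄} ∪ {bβ : β ∈ Ȳ}` by the whole generator, whose syndrome is zero, so both have the same
syndrome decrease. [cite: LeverrierTillichZemor2015, App. B (third case: "either x̄_a ∪ x̄_b, or its complement in g_ba"; arXiv v1 p0013 L40-44)] -/
theorem syndromeDecrease_parts_compl (H : Matrix B A (ZMod 2)) (b : B) (a : A) (σ : A × B → ZMod 2)
    {S : Finset A} {T : Finset B} (hS : S ⊆ nbrs Hᵀ b) (hT : T ⊆ nbrs H a) :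
    syndromeDecrease (expanderHX H) σ
        ((nbrs Hᵀ b \ S).image (fun α' => Sum.inl (α', a)) ∪ (nbrs H a \ T).image (fun β' => Sum.inr (b, β')))
      = syndromeDecrease (expanderHX H) σ
        (S.image (fun α' => Sum.inl (α', a)) ∪ T.image (fun β' => Sum.inr (b, β'))) := by
  classical
  -- the two flip syndromes coincide entrywise
  have hτ : expanderHX H *ᵥ flipVec ((nbrs Hᵀ b \ S).image (fun α' => (Sum.inl (α', a) : (A × A) ⊕ (B × B)))
        ∪ (nbrs H a \ T).image (fun β' => Sum.inr (b, β')))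
      = expanderHX H *ᵥ flipVec (S.image (fun α' => (Sum.inl (α', a) : (A × A) ⊕ (B × B)))
        ∪ T.image (fun β' => Sum.inr (b, β'))) := by
    ext ⟨α, β⟩
    rw [expanderHX_mulVec_flipVec_parts, expanderHX_mulVec_flipVec_parts]
    -- case analysis on `α ∈ Γ(b)`, `β ∈ Γ(a)`
    by_cases hα : H b α = 0
    · have hαS : α ∉ S := fun h => by
        have := mem_nbrs.1 (hS h); rw [Matrix.transpose_apply] at this; exact this hα
      have hαS' : α ∉ nbrs Hᵀ b \ S := fun h => by
        have := mem_nbrs.1 (Finset.mem_sdiff.1 h).1; rw [Matrix.transpose_apply] at this; exact this hα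
      rw [if_neg hαS, if_neg hαS', hα]
      simp
    · by_cases hβ : H β a = 0
      · have hβT : β ∉ T := fun h => (mem_nbrs.1 (hT h)) hβ
        have hβT' : β ∉ nbrs H a \ T := fun h => (mem_nbrs.1 (Finset.mem_sdiff.1 h).1) hβ
        rw [if_neg hβT, if_neg hβT', hβ]
        simp
      · have h1 : H b α = 1 := zmod2_eq_one_of_ne_zero' hα
        have h2 : H β a = 1 := zmod2_eq_one_of_ne_zero' hβ
        have hαmem : (α ∈ nbrs Hᵀ b \ S) ↔ α ∉ S := by
          rw [Finset.mem_sdiff, mem_nbrs, Matrix.transpose_apply]; exact ⟨fun h => h.2, fun h => ⟨hα, h⟩⟩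
        have hβmem : (β ∈ nbrs H a \ T) ↔ β ∉ T := by
          rw [Finset.mem_sdiff, mem_nbrs]; exact ⟨fun h => h.2, fun h => ⟨hβ, h⟩⟩
        rw [h1, h2]
        simp only [hαmem, hβmem]
        by_cases hs : α ∈ S <;> by_cases ht : β ∈ T <;> simp [hs, ht] <;> decide
  rw [syndromeDecrease, syndromeDecrease, hτ]


end QuantumExpander

end Literature.InformationTheory.QuantumCodes
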